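import Summits.Ventures.Crystal3D.Theorems.StickyWulffConstantGenericWallFloorCoveringRadius
import Summits.Ventures.Crystal3D.Theorems.StickyWulffConstantGenericWallFloorShellCount
import HarnessLib

/-!
# Slab sealing: no foreign ball fits inside a slab filled by a grain

HONEST FRAMING. Part of the venture `Summits/Ventures/Crystal3D` (cell `crystal3d-full`), helper for the
crux `GenericWallFloor` (stmt-Ventures-19480) of `route-Ventures-StickyWulffConstant`, line `WallLedgerG`,
module M4 of the rigid-bicrystal rung (RIGID-RUNG-ARCH on the item).  Rung credit only.

In `TwoSlabAdhesion` the bottom sample is the FULL set `P₁ = (A·Λ + t) ∩ {a ≤ x₂ ≤ b, x₀² + x₁² ≤ ρ²}`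
of grain balls in a slab of the cylinder, and `X ⊇ P₁` is `1`-separated.  By the covering radius of a
Barlow stacking (`exists_mem_barlowStacking_dist_sq_le_half`: every point is within `1/√2` of the moved
lattice) every point of the CORE `{a + 1 ≤ x₂ ≤ b − 1, x₀² + x₁² ≤ (ρ − 1)²}` is at distance `< 1` from a
ball of `P₁` (`exists_mem_sample_dist_lt_one`); hence `X` has no ball in the core other than the balls of
`P₁` (`eq_of_mem_core`): the extra balls of `X` near `P₁` live in the two unit boundary layers and the rim —
the "floor extras" and "rim balls" of the ledger.
-/

noncomputable section

namespace Summit.Ventures.Crystal3D.Theorems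

open Literature.MathematicalPhysics.StatisticalMechanics (barlowPos barlowStacking)

/-- Lateral bookkeeping: `|y|_lat ≤ ρ − 1` and `|y − p|²_lat ≤ ½` give `|p|_lat ≤ ρ`. -/
theorem lateral_sq_le_of_core (p0 p1 y0 y1 ρ : ℝ) (hρ : 1 ≤ ρ) (hy : y0 ^ 2 + y1 ^ 2 ≤ (ρ - 1) ^ 2)
    (hd : (y0 - p0) ^ 2 + (y1 - p1) ^ 2 ≤ 1 / 2) : p0 ^ 2 + p1 ^ 2 ≤ ρ ^ 2 := by
  have hCS : (y0 * (p0 - y0) + y1 * (p1 - y1)) ^ 2 ≤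
      (y0 ^ 2 + y1 ^ 2) * ((y0 - p0) ^ 2 + (y1 - p1) ^ 2) := by
    nlinarith [sq_nonneg (y0 * (p1 - y1) - y1 * (p0 - y0))]
  have hρ10 : 0 ≤ ρ - 1 := by linarith
  have hyd : (y0 * (p0 - y0) + y1 * (p1 - y1)) ^ 2 ≤ (ρ - 1) ^ 2 := by
    have : (y0 ^ 2 + y1 ^ 2) * ((y0 - p0) ^ 2 + (y1 - p1) ^ 2) ≤ (ρ - 1) ^ 2 * (1 / 2) :=
      mul_le_mul hy hd (by positivity) (by positivity)
    nlinarith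
  have hyd' : y0 * (p0 - y0) + y1 * (p1 - y1) ≤ ρ - 1 := by
    rw [← sq_abs] at hyd
    have := abs_le_of_sq_le_sq' hyd hρ10
    linarith [le_abs_self (y0 * (p0 - y0) + y1 * (p1 - y1)), this.2]
  have hexp : p0 ^ 2 + p1 ^ 2 =
      (y0 ^ 2 + y1 ^ 2) + 2 * (y0 * (p0 - y0) + y1 * (p1 - y1)) + ((y0 - p0) ^ 2 + (y1 - p1) ^ 2) := by
    ring
  nlinarith

/-- The lateral part of the squared distance: `(y₀ − p₀)² + (y₁ − p₁)² ≤ dist(y,p)²`. -/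
theorem lateral_sq_sub_le_dist_sq (y p : EuclideanSpace ℝ (Fin 3)) :
    (y 0 - p 0) ^ 2 + (y 1 - p 1) ^ 2 ≤ dist y p ^ 2 := by
  rw [EuclideanSpace.dist_eq, Real.sq_sqrt (Finset.sum_nonneg fun _ _ => sq_nonneg _)]
  simp only [Real.dist_eq, sq_abs]
  rw [Fin.sum_univ_three]
  nlinarith [sq_nonneg (y 2 - p 2)]

/-- **Every core point is within distance `< 1` of the slab sample.**  `Λ = A·B(σ) + t` a moved Barlow
stacking, `P ⊇` all balls of `Λ` in the window `[a, b]` and the disc `ρ`; then every point `x` with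
`a + 1 ≤ x₂ ≤ b − 1` and `x₀² + x₁² ≤ (ρ − 1)²` has a ball of `P` at distance `< 1` (indeed `≤ 1/√2`). -/
theorem exists_mem_sample_dist_lt_one (σ : ℤ → ℤ)
    (A : EuclideanSpace ℝ (Fin 3) ≃ₗᵢ[ℝ] EuclideanSpace ℝ (Fin 3)) (t : EuclideanSpace ℝ (Fin 3))
    (P : Finset (EuclideanSpace ℝ (Fin 3))) (a b ρ : ℝ) (hρ : 1 ≤ ρ)
    (hP : ∀ p : EuclideanSpace ℝ (Fin 3), p ∈ (fun y => A y + t) '' barlowStacking 1 (Real.sqrt (2 / 3)) σ →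
      a ≤ p 2 → p 2 ≤ b → p 0 ^ 2 + p 1 ^ 2 ≤ ρ ^ 2 → p ∈ P)
    (x : EuclideanSpace ℝ (Fin 3)) (hxa : a + 1 ≤ x 2) (hxb : x 2 ≤ b - 1)
    (hxr : x 0 ^ 2 + x 1 ^ 2 ≤ (ρ - 1) ^ 2) :
    ∃ p ∈ P, dist x p < 1 := by
  obtain ⟨p₀, hp₀, hd₀⟩ := exists_mem_barlowStacking_dist_sq_le_half σ (A.symm (x - t))
  set p : EuclideanSpace ℝ (Fin 3) := A p₀ + t with hp_def
  have hxp : x - p = A (A.symm (x - t) - p₀) := by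
    rw [map_sub, LinearIsometryEquiv.apply_symm_apply, hp_def]; abel
  have hdist : dist x p = dist (A.symm (x - t)) p₀ := by
    rw [dist_eq_norm, dist_eq_norm, hxp, LinearIsometryEquiv.norm_map]
  have hd : dist x p ^ 2 ≤ 1 / 2 := by rw [hdist]; exact hd₀
  have hdlt : dist x p < 1 := by nlinarith [dist_nonneg (x := x) (y := p)]
  have h2 := sq_sub_apply_le_dist_sq x p 2
  have h01 := lateral_sq_sub_le_dist_sq x p
  refine ⟨p, hP p ⟨p₀, hp₀, rfl⟩ ?_ ?_ ?_, hdlt⟩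
  · nlinarith [sq_nonneg (x 2 - p 2 - 1), sq_nonneg (x 2 - p 2 + 1)]
  · nlinarith [sq_nonneg (x 2 - p 2 - 1), sq_nonneg (x 2 - p 2 + 1)]
  · exact lateral_sq_le_of_core (p 0) (p 1) (x 0) (x 1) ρ hρ hxr (by linarith)

/-- **Sealing.**  If `X ⊇ P` is `1`-separated and `P` contains all balls of the moved stacking in the window
and disc, then the only balls of `X` in the core are balls of `P`. -/
theorem mem_sample_of_mem_core (σ : ℤ → ℤ)
    (A : EuclideanSpace ℝ (Fin 3) ≃ₗᵢ[ℝ] EuclideanSpace ℝ (Fin 3)) (t : EuclideanSpace ℝ (Fin 3))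
    (X P : Finset (EuclideanSpace ℝ (Fin 3))) (a b ρ : ℝ) (hρ : 1 ≤ ρ) (hPX : P ⊆ X)
    (hsep : ∀ x ∈ X, ∀ y ∈ X, x ≠ y → 1 ≤ dist x y)
    (hP : ∀ p : EuclideanSpace ℝ (Fin 3), p ∈ (fun y => A y + t) '' barlowStacking 1 (Real.sqrt (2 / 3)) σ →
      a ≤ p 2 → p 2 ≤ b → p 0 ^ 2 + p 1 ^ 2 ≤ ρ ^ 2 → p ∈ P)
    (x : EuclideanSpace ℝ (Fin 3)) (hx : x ∈ X) (hxa : a + 1 ≤ x 2) (hxb : x 2 ≤ b - 1)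
    (hxr : x 0 ^ 2 + x 1 ^ 2 ≤ (ρ - 1) ^ 2) : x ∈ P := by
  obtain ⟨p, hpP, hd⟩ := exists_mem_sample_dist_lt_one σ A t P a b ρ hρ hP x hxa hxb hxr
  by_contra hxP
  have hne : x ≠ p := fun h => hxP (h ▸ hpP)
  have := hsep x hx p (hPX hpP) hne
  linarith

end Summit.Ventures.Crystal3D.Theorems

end
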